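import Mathlib.Analysis.InnerProductSpace.PiL2
import Mathlib.Analysis.SpecialFunctions.JapaneseBracket
import Mathlib.MeasureTheory.Integral.DominatedConvergence
import Literature.Analysis.PDE.NewtonianKernel
import HarnessLib

/-!
# Route HardyPointSink — `HardyBalanceLaw`: integrability of the dominating weights on `ℝ³`

Helper file for item stmt-NavierStokesRegularity-8388 (`HardyBalanceLaw`). The dominated
convergence arguments of the Hardy balance law (regularised Newtonian weight `→ |x - x₀|⁻¹`)
use three dominating functions on `ℝ³`, built from the polynomial decay `(1 + ‖x‖)⁻²` of the
velocity and its gradient: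

* `F₀(x) = (1 + ‖x‖)⁻⁴` (Mathlib `integrable_one_add_norm`, `4 > 3`);
* `F_A(x) = (1 + ‖x‖)⁻⁴ |x - x₀|⁻¹` (the Hardy weight against `|u|²`, `|∇u|²`);
* `F_C(x) = (1 + ‖x‖)⁻² |x - x₀|⁻²` (the head flux `(|u|²/2 + p) u · (x - x₀)/|x - x₀|³`).

The singular factors are integrable on the unit ball about `x₀` (the tree's
`Newtonian.integrableOn_norm_sub_rpow_neg`, exponents `1, 2 < 3`) and bounded by a multiple of
`(1 + ‖x‖)⁻²` off it (`1 + ‖x‖ ≤ (1 + ‖x₀‖)(1 + ‖x - x₀‖)`). The file also packages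
dominated convergence on `ℝ³` with its uniform bound (`hardyPointSink_dct`,
`hardyPointSink_dct_zero`) and the bookkeeping of the scales `aₙ = (n+1)⁻²` and radii `n + 1`.
-/

noncomputable section

open MeasureTheory Metric Set Filter Topology
open Literature.Analysis.PDE

set_option linter.dupNamespace false -- nested layout Summit.<S>.<Sub>, Sub = S (D-0017)

namespace Summit.NavierStokesRegularity.NavierStokesRegularity.Theorems

/-! ### The nonsingular weight `(1 + ‖x‖)⁻⁴` -/

/-- `(1 + ‖x‖)^{-(k:ℝ)} = ((1 + ‖x‖)^k)⁻¹`. -/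
theorem hardyPointSink_rpow_neg_natCast (x : EuclideanSpace ℝ (Fin 3)) (k : ℕ) :
    (1 + ‖x‖) ^ (-(k : ℝ)) = ((1 + ‖x‖) ^ k)⁻¹ := by
  rw [Real.rpow_neg (by positivity), Real.rpow_natCast]

/-- **`(1 + ‖x‖)⁻⁴` is integrable on `ℝ³`.** -/
theorem hardyPointSink_integrable_F0 : Integrable (fun x : EuclideanSpace ℝ (Fin 3) => ((1 + ‖x‖) ^ 4)⁻¹) := by
  have h := integrable_one_add_norm (E := (EuclideanSpace ℝ (Fin 3))) (μ := volume) (r := 4)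
    (by rw [finrank_euclideanSpace_fin]; norm_num)
  refine h.congr (Eventually.of_forall fun x => ?_)
  have := hardyPointSink_rpow_neg_natCast x 4
  simp only [Nat.cast_ofNat] at this
  exact this

/-- `(1 + ‖x‖)⁻² ≤ 1` and friends: `((1 + ‖x‖)^k)⁻¹ ≤ 1`. -/
theorem hardyPointSink_inv_one_add_norm_pow_le_one (x : EuclideanSpace ℝ (Fin 3)) (k : ℕ) : ((1 + ‖x‖) ^ k)⁻¹ ≤ 1 := by
  apply inv_le_one_of_one_le₀
  exact one_le_pow₀ (by linarith [norm_nonneg x])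

/-- `((1 + ‖x‖)^4)⁻¹ ≤ ((1 + ‖x‖)^2)⁻¹`. -/
theorem hardyPointSink_inv_pow_four_le_inv_pow_two (x : EuclideanSpace ℝ (Fin 3)) :
    ((1 + ‖x‖) ^ 4)⁻¹ ≤ ((1 + ‖x‖) ^ 2)⁻¹ := by
  have h1 : (1 : ℝ) ≤ 1 + ‖x‖ := by linarith [norm_nonneg x]
  apply inv_anti₀ (by positivity)
  exact pow_le_pow_right₀ h1 (by norm_num)

/-! ### The triangle inequality in weight form -/

/-- `1 + ‖x‖ ≤ (1 + ‖x₀‖)(1 + ‖x - x₀‖)`. -/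
theorem hardyPointSink_one_add_norm_le (x₀ x : EuclideanSpace ℝ (Fin 3)) :
    1 + ‖x‖ ≤ (1 + ‖x₀‖) * (1 + ‖x - x₀‖) := by
  have h1 : ‖x‖ ≤ ‖x₀‖ + ‖x - x₀‖ := by
    calc ‖x‖ = ‖x₀ + (x - x₀)‖ := by rw [add_sub_cancel]
      _ ≤ ‖x₀‖ + ‖x - x₀‖ := norm_add_le _ _
  nlinarith [norm_nonneg x₀, norm_nonneg (x - x₀)]

/-- Off the unit ball about `x₀`: `|x - x₀|⁻¹ ≤ 2(1 + ‖x₀‖)(1 + ‖x‖)⁻¹`. -/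
theorem hardyPointSink_inv_norm_sub_le {x₀ x : (EuclideanSpace ℝ (Fin 3))} (hx : 1 ≤ ‖x - x₀‖) :
    ‖x - x₀‖⁻¹ ≤ 2 * (1 + ‖x₀‖) * (1 + ‖x‖)⁻¹ := by
  have h1 := hardyPointSink_one_add_norm_le x₀ x
  have hr : 0 < ‖x - x₀‖ := by linarith
  have h2 : 1 + ‖x - x₀‖ ≤ 2 * ‖x - x₀‖ := by linarith
  have h3 : 1 + ‖x‖ ≤ (1 + ‖x₀‖) * (2 * ‖x - x₀‖) :=
    h1.trans (mul_le_mul_of_nonneg_left h2 (by positivity))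
  rw [inv_le_iff_one_le_mul₀ hr]
  have h4 : 0 < 1 + ‖x‖ := by positivity
  calc (1 : ℝ) = (1 + ‖x‖) * (1 + ‖x‖)⁻¹ := by field_simp
    _ ≤ (1 + ‖x₀‖) * (2 * ‖x - x₀‖) * (1 + ‖x‖)⁻¹ :=
        mul_le_mul_of_nonneg_right h3 (by positivity)
    _ = 2 * (1 + ‖x₀‖) * (1 + ‖x‖)⁻¹ * ‖x - x₀‖ := by ring

/-- Off the unit ball about `x₀`: `|x - x₀|⁻² ≤ 4(1 + ‖x₀‖)²((1 + ‖x‖)²)⁻¹`. -/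
theorem hardyPointSink_inv_norm_sub_sq_le {x₀ x : (EuclideanSpace ℝ (Fin 3))} (hx : 1 ≤ ‖x - x₀‖) :
    (‖x - x₀‖ ^ 2)⁻¹ ≤ 4 * (1 + ‖x₀‖) ^ 2 * ((1 + ‖x‖) ^ 2)⁻¹ := by
  have h := hardyPointSink_inv_norm_sub_le hx
  have h0 : 0 ≤ ‖x - x₀‖⁻¹ := inv_nonneg.2 (norm_nonneg _)
  calc (‖x - x₀‖ ^ 2)⁻¹ = ‖x - x₀‖⁻¹ * ‖x - x₀‖⁻¹ := by rw [sq, mul_inv]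
    _ ≤ (2 * (1 + ‖x₀‖) * (1 + ‖x‖)⁻¹) * (2 * (1 + ‖x₀‖) * (1 + ‖x‖)⁻¹) :=
        mul_le_mul h h h0 (h0.trans h)
    _ = 4 * (1 + ‖x₀‖) ^ 2 * ((1 + ‖x‖) ^ 2)⁻¹ := by rw [sq, sq, mul_inv]; ring

/-! ### The singular factors on the unit ball -/

/-- `|x - x₀|⁻¹` is integrable on the unit ball about `x₀` (`1 < 3`). -/
theorem hardyPointSink_integrableOn_ball_inv_norm_sub (x₀ : EuclideanSpace ℝ (Fin 3)) :
    IntegrableOn (fun x : EuclideanSpace ℝ (Fin 3) => ‖x - x₀‖⁻¹) (ball x₀ 1) := by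
  have h := Newtonian.integrableOn_norm_sub_rpow_neg (E := (EuclideanSpace ℝ (Fin 3)))
    (by rw [finrank_euclideanSpace_fin]) (s := 1) (by rw [finrank_euclideanSpace_fin]; norm_num)
    x₀ x₀ 1
  refine h.congr_fun (fun x _ => ?_) measurableSet_ball
  simp only
  rw [Real.rpow_neg_one, norm_sub_rev]

/-- `|x - x₀|⁻²` is integrable on the unit ball about `x₀` (`2 < 3`). -/
theorem hardyPointSink_integrableOn_ball_inv_norm_sub_sq (x₀ : EuclideanSpace ℝ (Fin 3)) :
    IntegrableOn (fun x : EuclideanSpace ℝ (Fin 3) => (‖x - x₀‖ ^ 2)⁻¹) (ball x₀ 1) := by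
  have h := Newtonian.integrableOn_norm_sub_rpow_neg (E := (EuclideanSpace ℝ (Fin 3)))
    (by rw [finrank_euclideanSpace_fin]) (s := 2) (by rw [finrank_euclideanSpace_fin]; norm_num)
    x₀ x₀ 1
  refine h.congr_fun (fun x _ => ?_) measurableSet_ball
  simp only
  rw [Real.rpow_neg (norm_nonneg _), norm_sub_rev]
  norm_cast

/-! ### The dominating functions `F_A`, `F_C` -/

/-- `F_A` is measurable. -/
theorem hardyPointSink_measurable_FA (x₀ : EuclideanSpace ℝ (Fin 3)) :
    Measurable (fun x : EuclideanSpace ℝ (Fin 3) => ((1 + ‖x‖) ^ 4)⁻¹ * ‖x - x₀‖⁻¹) := by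
  fun_prop

/-- `F_C` is measurable. -/
theorem hardyPointSink_measurable_FC (x₀ : EuclideanSpace ℝ (Fin 3)) :
    Measurable (fun x : EuclideanSpace ℝ (Fin 3) => ((1 + ‖x‖) ^ 2)⁻¹ * (‖x - x₀‖ ^ 2)⁻¹) := by
  fun_prop

/-- **`F_A(x) = (1 + ‖x‖)⁻⁴ |x - x₀|⁻¹` is integrable on `ℝ³`.** It is dominated by
`1_{B(x₀,1)} |x - x₀|⁻¹ + (1 + ‖x‖)⁻⁴`. -/
theorem hardyPointSink_integrable_FA (x₀ : EuclideanSpace ℝ (Fin 3)) :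
    Integrable (fun x : EuclideanSpace ℝ (Fin 3) => ((1 + ‖x‖) ^ 4)⁻¹ * ‖x - x₀‖⁻¹) := by
  have hG : Integrable (fun x : EuclideanSpace ℝ (Fin 3) => (ball x₀ 1).indicator (fun x => ‖x - x₀‖⁻¹) x +
      ((1 + ‖x‖) ^ 4)⁻¹) :=
    ((hardyPointSink_integrableOn_ball_inv_norm_sub x₀).integrable_indicator measurableSet_ball).add
      hardyPointSink_integrable_F0
  refine hG.mono' (hardyPointSink_measurable_FA x₀).aestronglyMeasurable
    (Eventually.of_forall fun x => ?_)
  have h0 : 0 ≤ ((1 + ‖x‖) ^ 4)⁻¹ := by positivity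
  have h1 : 0 ≤ ‖x - x₀‖⁻¹ := inv_nonneg.2 (norm_nonneg _)
  rw [Real.norm_eq_abs, abs_of_nonneg (mul_nonneg h0 h1)]
  by_cases hx : x ∈ ball x₀ 1
  · rw [indicator_of_mem hx]
    calc ((1 + ‖x‖) ^ 4)⁻¹ * ‖x - x₀‖⁻¹ ≤ 1 * ‖x - x₀‖⁻¹ :=
          mul_le_mul_of_nonneg_right (hardyPointSink_inv_one_add_norm_pow_le_one x 4) h1
      _ ≤ ‖x - x₀‖⁻¹ + ((1 + ‖x‖) ^ 4)⁻¹ := by linarith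
  · rw [indicator_of_notMem hx, zero_add]
    have hx' : 1 ≤ ‖x - x₀‖ := by
      rw [mem_ball, dist_eq_norm, not_lt] at hx; exact hx
    have h2 : ‖x - x₀‖⁻¹ ≤ 1 := inv_le_one_of_one_le₀ hx'
    calc ((1 + ‖x‖) ^ 4)⁻¹ * ‖x - x₀‖⁻¹ ≤ ((1 + ‖x‖) ^ 4)⁻¹ * 1 :=
          mul_le_mul_of_nonneg_left h2 h0
      _ = ((1 + ‖x‖) ^ 4)⁻¹ := mul_one _

/-- **`F_C(x) = (1 + ‖x‖)⁻² |x - x₀|⁻²` is integrable on `ℝ³`.** It is dominated by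
`1_{B(x₀,1)} |x - x₀|⁻² + 4(1 + ‖x₀‖)² (1 + ‖x‖)⁻⁴`. -/
theorem hardyPointSink_integrable_FC (x₀ : EuclideanSpace ℝ (Fin 3)) :
    Integrable (fun x : EuclideanSpace ℝ (Fin 3) => ((1 + ‖x‖) ^ 2)⁻¹ * (‖x - x₀‖ ^ 2)⁻¹) := by
  have hG : Integrable (fun x : EuclideanSpace ℝ (Fin 3) => (ball x₀ 1).indicator (fun x => (‖x - x₀‖ ^ 2)⁻¹) x +
      4 * (1 + ‖x₀‖) ^ 2 * ((1 + ‖x‖) ^ 4)⁻¹) :=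
    ((hardyPointSink_integrableOn_ball_inv_norm_sub_sq x₀).integrable_indicator
      measurableSet_ball).add (hardyPointSink_integrable_F0.const_mul _)
  refine hG.mono' (hardyPointSink_measurable_FC x₀).aestronglyMeasurable
    (Eventually.of_forall fun x => ?_)
  have h0 : 0 ≤ ((1 + ‖x‖) ^ 2)⁻¹ := by positivity
  have h1 : 0 ≤ (‖x - x₀‖ ^ 2)⁻¹ := by positivity
  have h4 : 0 ≤ 4 * (1 + ‖x₀‖) ^ 2 * ((1 + ‖x‖) ^ 4)⁻¹ := by positivity
  rw [Real.norm_eq_abs, abs_of_nonneg (mul_nonneg h0 h1)]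
  by_cases hx : x ∈ ball x₀ 1
  · rw [indicator_of_mem hx]
    calc ((1 + ‖x‖) ^ 2)⁻¹ * (‖x - x₀‖ ^ 2)⁻¹ ≤ 1 * (‖x - x₀‖ ^ 2)⁻¹ :=
          mul_le_mul_of_nonneg_right (hardyPointSink_inv_one_add_norm_pow_le_one x 2) h1
      _ ≤ (‖x - x₀‖ ^ 2)⁻¹ + 4 * (1 + ‖x₀‖) ^ 2 * ((1 + ‖x‖) ^ 4)⁻¹ := by linarith
  · rw [indicator_of_notMem hx, zero_add]
    have hx' : 1 ≤ ‖x - x₀‖ := by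
      rw [mem_ball, dist_eq_norm, not_lt] at hx; exact hx
    have h2 := hardyPointSink_inv_norm_sub_sq_le hx'
    calc ((1 + ‖x‖) ^ 2)⁻¹ * (‖x - x₀‖ ^ 2)⁻¹
        ≤ ((1 + ‖x‖) ^ 2)⁻¹ * (4 * (1 + ‖x₀‖) ^ 2 * ((1 + ‖x‖) ^ 2)⁻¹) :=
          mul_le_mul_of_nonneg_left h2 h0
      _ = 4 * (1 + ‖x₀‖) ^ 2 * ((1 + ‖x‖) ^ 4)⁻¹ := by
          have : ((1 + ‖x‖) ^ 4 : ℝ) = (1 + ‖x‖) ^ 2 * (1 + ‖x‖) ^ 2 := by ring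
          rw [this, mul_inv]
          ring

/-- `F_B(x) = (1 + ‖x‖)⁻⁴ |x - x₀|⁻²` is integrable on `ℝ³` (it is at most `F_C`). -/
theorem hardyPointSink_integrable_FB (x₀ : EuclideanSpace ℝ (Fin 3)) :
    Integrable (fun x : EuclideanSpace ℝ (Fin 3) => ((1 + ‖x‖) ^ 4)⁻¹ * (‖x - x₀‖ ^ 2)⁻¹) := by
  refine (hardyPointSink_integrable_FC x₀).mono' ?_ (Eventually.of_forall fun x => ?_)
  · have : Measurable (fun x : EuclideanSpace ℝ (Fin 3) => ((1 + ‖x‖) ^ 4)⁻¹ * (‖x - x₀‖ ^ 2)⁻¹) := by fun_prop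
    exact this.aestronglyMeasurable
  · have h0 : 0 ≤ ((1 + ‖x‖) ^ 4)⁻¹ := by positivity
    have h1 : 0 ≤ (‖x - x₀‖ ^ 2)⁻¹ := by positivity
    rw [Real.norm_eq_abs, abs_of_nonneg (mul_nonneg h0 h1)]
    exact mul_le_mul_of_nonneg_right (hardyPointSink_inv_pow_four_le_inv_pow_two x) h1

/-- Points differ from `x₀` almost everywhere (Lebesgue measure has no atoms). -/
theorem hardyPointSink_ae_ne (x₀ : EuclideanSpace ℝ (Fin 3)) : ∀ᵐ x : EuclideanSpace ℝ (Fin 3), x ≠ x₀ := by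
  have h : (volume : Measure (EuclideanSpace ℝ (Fin 3))) {x₀} = 0 := measure_singleton x₀
  rw [ae_iff]
  simpa only [ne_eq, not_not, setOf_eq_eq_singleton] using h

/-! ### Dominated convergence, packaged with the uniform bound -/

/-- Dominated convergence on `ℝ³` together with the uniform bound `|∫ Fₙ| ≤ ∫ bound` and the
integrability of every `Fₙ`. -/
theorem hardyPointSink_dct {F : ℕ → (EuclideanSpace ℝ (Fin 3)) → ℝ} {f : (EuclideanSpace ℝ (Fin 3)) → ℝ} {bound : (EuclideanSpace ℝ (Fin 3)) → ℝ}
    (hmeas : ∀ n, AEStronglyMeasurable (F n) volume) (hint : Integrable bound)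
    (hb : ∀ n, ∀ᵐ x : EuclideanSpace ℝ (Fin 3), ‖F n x‖ ≤ bound x)
    (hlim : ∀ᵐ x : EuclideanSpace ℝ (Fin 3), Tendsto (fun n => F n x) atTop (𝓝 (f x))) :
    Tendsto (fun n => ∫ x, F n x) atTop (𝓝 (∫ x, f x)) ∧ (∀ n, |∫ x, F n x| ≤ ∫ x, bound x) ∧
      ∀ n, Integrable (F n) :=
  ⟨tendsto_integral_of_dominated_convergence bound hmeas hint hb hlim, fun n => by
    rw [← Real.norm_eq_abs]; exact norm_integral_le_of_norm_le hint (hb n),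
    fun n => hint.mono' (hmeas n) (hb n)⟩

/-- A cut-off family equal to `1` on `B̄(x₀, n+1)` is eventually `1` at every point. -/
theorem hardyPointSink_eventually_cutoff_eq_one (x₀ : EuclideanSpace ℝ (Fin 3)) {χ : ℕ → (EuclideanSpace ℝ (Fin 3)) → ℝ}
    (hχone : ∀ (n : ℕ) (x : EuclideanSpace ℝ (Fin 3)), dist x x₀ ≤ (n : ℝ) + 1 → χ n x = 1) (x : EuclideanSpace ℝ (Fin 3)) :
    ∀ᶠ n in atTop, χ n x = 1 := by
  filter_upwards [eventually_ge_atTop ⌈dist x x₀⌉₊] with n hn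
  refine hχone n x ?_
  have h1 : dist x x₀ ≤ ⌈dist x x₀⌉₊ := Nat.le_ceil _
  have h2 : (⌈dist x x₀⌉₊ : ℝ) ≤ n := by exact_mod_cast hn
  linarith

/-! ### Bookkeeping for the scales `aₙ = (n+1)⁻²` -/

/-- `aₙ = (n+1)⁻² > 0`. -/
theorem hardyPointSink_seq_pos (n : ℕ) : 0 < (((n : ℝ) + 1)⁻¹) ^ 2 := by positivity

/-- `aₙ = (n+1)⁻² ≤ 1`. -/
theorem hardyPointSink_seq_le_one (n : ℕ) : (((n : ℝ) + 1)⁻¹) ^ 2 ≤ 1 := by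
  have h1 : (1 : ℝ) ≤ (n : ℝ) + 1 := by
    have := (Nat.cast_nonneg n : (0 : ℝ) ≤ n); linarith
  have h2 : ((n : ℝ) + 1)⁻¹ ≤ 1 := inv_le_one_of_one_le₀ h1
  have h3 : 0 ≤ ((n : ℝ) + 1)⁻¹ := by positivity
  nlinarith

/-- Every point is eventually inside the ball `B(x₀, n+1)`. -/
theorem hardyPointSink_eventually_dist_lt (x₀ x : EuclideanSpace ℝ (Fin 3)) : ∀ᶠ n : ℕ in atTop, dist x x₀ < (n : ℝ) + 1 := by
  filter_upwards [eventually_ge_atTop ⌈dist x x₀⌉₊] with n hn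
  have h1 : dist x x₀ ≤ ⌈dist x x₀⌉₊ := Nat.le_ceil _
  have h2 : (⌈dist x x₀⌉₊ : ℝ) ≤ n := by exact_mod_cast hn
  linarith

/-- Off the ball `B(x₀, n+1)`: `1 ≤ ‖x - x₀‖`, so inverse powers of `‖x - x₀‖` are at most `1`. -/
theorem hardyPointSink_one_le_norm_sub {x₀ x : (EuclideanSpace ℝ (Fin 3))} {n : ℕ} (hx : (n : ℝ) + 1 ≤ dist x x₀) :
    1 ≤ ‖x - x₀‖ := by
  rw [dist_eq_norm] at hx
  have := (Nat.cast_nonneg n : (0 : ℝ) ≤ n)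
  linarith

/-- A sequence of integrals that is eventually zero pointwise and dominated tends to `0`, with
the uniform bound and the integrability of every term. -/
theorem hardyPointSink_dct_zero {F : ℕ → (EuclideanSpace ℝ (Fin 3)) → ℝ} {bound : (EuclideanSpace ℝ (Fin 3)) → ℝ}
    (hmeas : ∀ n, AEStronglyMeasurable (F n) volume) (hint : Integrable bound)
    (hb : ∀ n, ∀ᵐ x : EuclideanSpace ℝ (Fin 3), ‖F n x‖ ≤ bound x) (hlim : ∀ x : EuclideanSpace ℝ (Fin 3), ∀ᶠ n in atTop, F n x = 0) :
    Tendsto (fun n => ∫ x, F n x) atTop (𝓝 0) ∧ (∀ n, |∫ x, F n x| ≤ ∫ x, bound x) ∧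
      ∀ n, Integrable (F n) := by
  have h := hardyPointSink_dct (f := fun _ => 0) hmeas hint hb (Eventually.of_forall fun x =>
    tendsto_const_nhds.congr' (by filter_upwards [hlim x] with n hn using hn.symm))
  rw [integral_zero] at h
  exact h

end Summit.NavierStokesRegularity.NavierStokesRegularity.Theorems

end
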